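import Mathlib
import HarnessLib
import Summits.ValiantsHypothesis.ValiantsHypothesis.Theorems.MonotoneRestorationOrbitRestorationQPBipartiteSplitting

/-!
# Doubling versus the bipartite double cover: for EVERY graph `X`, no matrix-symmetric polynomial separates `X ⊔ X` from `X × K₂`
(crux `OrbitRestorationQP`, stmt-ValiantsHypothesis-18293, and the cruxes 16191 / 15886 — the symmetric-input obstruction of
`…BipartiteSplitting.lean` in its general form)

Namespace `Summit.ValiantsHypothesis.ValiantsHypothesis.Theorems.OrbitRestorationQPDepthThreeRung.BipartiteSplitting`.
Definition-free.

`…BipartiteSplitting.lean` records that a matrix-symmetric polynomial takes equal values on the adjacency matrices of two graphs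
whose adjacency relations are ALIGNED by a pair of independent permutations, and certifies the pair `2·C₃ / C₆`.  That pair is the
case `X = K₃` of a uniform phenomenon, certified here for every simple graph `X` on any vertex type `V`: on `Fin 2 × V` let

  `D(X)` := two disjoint copies of `X`      (`(s,v) ~ (s',v')` iff `s = s'` and `X.Adj v v'`; `= ⊥ □ X`),
  `K(X)` := the bipartite double cover     (`(s,v) ~ (s',v')` iff `s ≠ s'` and `X.Adj v v'`; `= K₂ × X`),

both written with `SimpleGraph.fromRel`.  Then `K(X).Adj p (τ q) ↔ D(X).Adj p q` for `τ = swap × id` (flip the `K₂`-coordinate of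
the COLUMN index only): the two graphs have the same bipartite splitting.  Consequently:

* `eval_eq_of_aligned_type`, `eval_indicator_eq_of_adj_iff_type` — the alignment lemma over an arbitrary index type;
* `doubleCover_aligned` — the alignment `(1, swap × id)` of `K(X)` with `D(X)`;
* `eval_twoCopies_eq_eval_doubleCover` — **every polynomial in the variables `x_{pq}`, `p q : Fin 2 × V`, invariant under
  independent row and column permutations takes the same value on the adjacency matrices of `D(X)` and `K(X)`**;
* `not_iso_twoCopies_doubleCover` — while `D(X) ≇ K(X)` as soon as `X` is not bipartite (`K(X)` is `2`-colourable by the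
  `K₂`-coordinate, `D(X)` contains `X`);
* `doubleCover_aligned_fin`, `eval_twoCopies_eq_eval_doubleCover_fin`, `…_family` — the same transported to the vertex set
  `Fin (2m)` along `finProdFinEquiv`, i.e. in the exact currency of the route's kill instruments
  (`RungKill.restorationOn_false_of_separating`, `not_qpOrbitSymmetric_of_polylogSeparating`): for a matrix-symmetric family `f`,
  `f (2m)` never separates the doubling of an `m`-vertex graph from its bipartite double cover — although for non-bipartite `X`
  these pairs are separated by an odd-cycle count, i.e. by `C^3`.  Separating witnesses must differ ON THEIR DOUBLE COVERS.

Honest label: refuter-side bookkeeping (a constraint on separating witnesses); no stub closed; VP ≠ VNP untouched. [folklore]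
-/

noncomputable section

open scoped Classical

-- `Summit.ValiantsHypothesis.ValiantsHypothesis.…` is the tree's single-conjunct layout (Sub = Summit).
set_option linter.dupNamespace false

namespace Summit.ValiantsHypothesis.ValiantsHypothesis.Theorems.OrbitRestorationQPDepthThreeRung.BipartiteSplitting

open MvPolynomial Equiv

/-! ### The alignment lemma over an arbitrary index type -/

/-- Aligned input matrices are not separated (arbitrary index type `V`): if `p ∈ R[x_{uv} : u v ∈ V]` is invariant under
independent row and column permutations and `A (σ u, τ v) = B (u, v)`, then `eval A p = eval B p`. [folklore] -/
theorem eval_eq_of_aligned_type {V : Type*} {R : Type*} [CommSemiring R] (p : MvPolynomial (V × V) R)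
    (hp : ∀ σ τ : Perm V, rename (fun q : V × V => (σ q.1, τ q.2)) p = p)
    (A B : V × V → R) (σ τ : Perm V) (hAB : ∀ u v, A (σ u, τ v) = B (u, v)) :
    eval A p = eval B p := by
  have hfun : (A ∘ fun q : V × V => (σ q.1, τ q.2)) = B := funext fun q => by simpa using hAB q.1 q.2
  conv_lhs => rw [← hp σ τ]
  rw [eval_rename, hfun]

/-- Graph form over an arbitrary vertex type: aligned adjacency relations give equal values of every matrix-symmetric `p` on
the two adjacency matrices. [folklore] -/
theorem eval_indicator_eq_of_adj_iff_type {V : Type*} {R : Type*} [CommSemiring R] (p : MvPolynomial (V × V) R)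
    (hp : ∀ σ τ : Perm V, rename (fun q : V × V => (σ q.1, τ q.2)) p = p)
    (X Y : SimpleGraph V) (σ τ : Perm V) (h : ∀ u v, X.Adj (σ u) (τ v) ↔ Y.Adj u v) :
    eval (Set.indicator {uv : V × V | X.Adj uv.1 uv.2} 1) p =
      eval (Set.indicator {uv : V × V | Y.Adj uv.1 uv.2} 1) p := by
  refine eval_eq_of_aligned_type p hp _ _ σ τ fun u v => ?_
  by_cases hY : Y.Adj u v
  · have hX : X.Adj (σ u) (τ v) := (h u v).2 hY
    rw [Set.indicator_of_mem (show ((σ u, τ v) : V × V) ∈ {uv : V × V | X.Adj uv.1 uv.2} from hX),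
      Set.indicator_of_mem (show ((u, v) : V × V) ∈ {uv : V × V | Y.Adj uv.1 uv.2} from hY)]
    rfl
  · have hX : ¬ X.Adj (σ u) (τ v) := fun hX => hY ((h u v).1 hX)
    rw [Set.indicator_of_notMem (show ((σ u, τ v) : V × V) ∉ {uv : V × V | X.Adj uv.1 uv.2} from hX),
      Set.indicator_of_notMem (show ((u, v) : V × V) ∉ {uv : V × V | Y.Adj uv.1 uv.2} from hY)]

/-! ### Doubling versus double cover -/

/-- In `Fin 2`, "different from the swap of `s'`" means "equal to `s'`". [folklore] -/
theorem fin_two_ne_swap_iff (s s' : Fin 2) : s ≠ Equiv.swap 0 1 s' ↔ s = s' := by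
  revert s s'
  decide

/-- **The doubling `D(X)` and the bipartite double cover `K(X)` are aligned**: with `τ = swap × id` on the column index,
`K(X).Adj p (τ q) ↔ D(X).Adj p q`. [folklore] -/
theorem doubleCover_aligned {V : Type*} (X : SimpleGraph V) :
    ∃ σ τ : Perm (Fin 2 × V), ∀ p q : Fin 2 × V,
      (SimpleGraph.fromRel fun a b : Fin 2 × V => a.1 ≠ b.1 ∧ X.Adj a.2 b.2).Adj (σ p) (τ q) ↔
        (SimpleGraph.fromRel fun a b : Fin 2 × V => a.1 = b.1 ∧ X.Adj a.2 b.2).Adj p q := by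
  refine ⟨Equiv.refl _, (Equiv.swap (0 : Fin 2) 1).prodCongr (Equiv.refl V), fun p q => ?_⟩
  obtain ⟨s, v⟩ := p
  obtain ⟨s', v'⟩ := q
  simp only [Equiv.refl_apply, Equiv.prodCongr_apply, Prod.map_apply, SimpleGraph.fromRel_adj, ne_eq, Prod.mk.injEq]
  have hsw := fin_two_ne_swap_iff s s'
  have hsw' : ¬ Equiv.swap 0 1 s' = s ↔ s = s' := by rw [← hsw]; exact ⟨fun h h' => h h'.symm, fun h h' => h h'.symm⟩
  constructor
  · rintro ⟨-, (⟨h1, h2⟩ | ⟨h1, h2⟩)⟩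
    · exact ⟨fun h => h2.ne h.2, Or.inl ⟨hsw.1 h1, h2⟩⟩
    · exact ⟨fun h => h2.ne h.2.symm, Or.inl ⟨hsw'.1 h1, h2.symm⟩⟩
  · rintro ⟨-, (⟨h1, h2⟩ | ⟨h1, h2⟩)⟩
    · exact ⟨fun h => h2.ne h.2, Or.inl ⟨hsw.2 h1, h2⟩⟩
    · exact ⟨fun h => h2.ne h.2.symm, Or.inl ⟨hsw.2 h1.symm, h2.symm⟩⟩

/-- **NO MATRIX-SYMMETRIC POLYNOMIAL SEPARATES `X ⊔ X` FROM `X × K₂`.**  For every simple graph `X` on `V`, every commutative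
semiring `R` and every `p ∈ R[x_{ab} : a b ∈ Fin 2 × V]` invariant under independent row and column permutations, the values of `p`
at the adjacency matrices of the doubling `D(X)` and of the bipartite double cover `K(X)` coincide. [folklore] -/
theorem eval_twoCopies_eq_eval_doubleCover {V : Type*} (X : SimpleGraph V) {R : Type*} [CommSemiring R]
    (p : MvPolynomial ((Fin 2 × V) × (Fin 2 × V)) R)
    (hp : ∀ σ τ : Perm (Fin 2 × V), rename (fun q : (Fin 2 × V) × (Fin 2 × V) => (σ q.1, τ q.2)) p = p) :
    eval (Set.indicator {ab : (Fin 2 × V) × (Fin 2 × V) |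
        (SimpleGraph.fromRel fun a b : Fin 2 × V => a.1 = b.1 ∧ X.Adj a.2 b.2).Adj ab.1 ab.2} 1) p =
      eval (Set.indicator {ab : (Fin 2 × V) × (Fin 2 × V) |
        (SimpleGraph.fromRel fun a b : Fin 2 × V => a.1 ≠ b.1 ∧ X.Adj a.2 b.2).Adj ab.1 ab.2} 1) p := by
  obtain ⟨σ, τ, h⟩ := doubleCover_aligned X
  exact (eval_indicator_eq_of_adj_iff_type p hp _ _ σ τ h).symm

/-- … although the two graphs are NOT isomorphic whenever `X` is not bipartite: `K(X)` is `2`-colourable by the `K₂`-coordinate and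
`D(X)` contains a copy of `X`. [folklore] -/
theorem not_iso_twoCopies_doubleCover {V : Type*} (X : SimpleGraph V) (hX : ¬ X.Colorable 2) :
    IsEmpty ((SimpleGraph.fromRel fun a b : Fin 2 × V => a.1 = b.1 ∧ X.Adj a.2 b.2) ≃g
      (SimpleGraph.fromRel fun a b : Fin 2 × V => a.1 ≠ b.1 ∧ X.Adj a.2 b.2)) := by
  refine ⟨fun e => hX ?_⟩
  -- `K(X)` is 2-colourable by the first coordinate
  have hK : (SimpleGraph.fromRel fun a b : Fin 2 × V => a.1 ≠ b.1 ∧ X.Adj a.2 b.2).Colorable 2 := by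
    have C : (SimpleGraph.fromRel fun a b : Fin 2 × V => a.1 ≠ b.1 ∧ X.Adj a.2 b.2).Coloring (Fin 2) :=
      SimpleGraph.Coloring.mk (fun a => a.1) (by
        rintro a b hab
        rw [SimpleGraph.fromRel_adj] at hab
        rcases hab.2 with ⟨h, -⟩ | ⟨h, -⟩
        · exact h
        · exact fun h' => h h'.symm)
    exact ⟨C⟩
  -- `X` maps into `D(X)` (copy `0`), hence into `K(X)` through `e`
  have ι : X →g (SimpleGraph.fromRel fun a b : Fin 2 × V => a.1 = b.1 ∧ X.Adj a.2 b.2) :=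
    { toFun := fun v => ((0 : Fin 2), v)
      map_rel' := by
        intro v w hvw
        rw [SimpleGraph.fromRel_adj]
        exact ⟨fun h => hvw.ne (Prod.mk.inj h).2, Or.inl ⟨rfl, hvw⟩⟩ }
  exact SimpleGraph.Colorable.of_hom (e.toHom.comp ι) hK

/-! ### Transport to the vertex set `Fin (2m)` (the currency of the kill instruments) -/

/-- The alignment on `Fin (2m)`: pull `D(X)` and `K(X)` back along `finProdFinEquiv : Fin 2 × Fin m ≃ Fin (2m)`; the column
permutation is the conjugate of `swap × id`. [folklore] -/
theorem doubleCover_aligned_fin {m : ℕ} (X : SimpleGraph (Fin m)) :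
    ∃ σ τ : Perm (Fin (2 * m)), ∀ i j : Fin (2 * m),
      ((SimpleGraph.fromRel fun a b : Fin 2 × Fin m => a.1 ≠ b.1 ∧ X.Adj a.2 b.2).comap
          (finProdFinEquiv.symm : Fin (2 * m) → Fin 2 × Fin m)).Adj (σ i) (τ j) ↔
        ((SimpleGraph.fromRel fun a b : Fin 2 × Fin m => a.1 = b.1 ∧ X.Adj a.2 b.2).comap
          (finProdFinEquiv.symm : Fin (2 * m) → Fin 2 × Fin m)).Adj i j := by
  obtain ⟨σ, τ, h⟩ := doubleCover_aligned X
  refine ⟨(finProdFinEquiv.symm : Fin (2 * m) ≃ Fin 2 × Fin m).symm.permCongr σ,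
    (finProdFinEquiv.symm : Fin (2 * m) ≃ Fin 2 × Fin m).symm.permCongr τ, fun i j => ?_⟩
  simp only [SimpleGraph.comap_adj, Equiv.permCongr_apply, Equiv.symm_symm, Equiv.symm_apply_apply]
  exact h _ _

/-- **On `Fin (2m)`: no matrix-symmetric polynomial at level `2m` separates the doubling of an `m`-vertex graph from its bipartite
double cover** (both realised on `Fin (2m)` through `finProdFinEquiv`). [folklore] -/
theorem eval_twoCopies_eq_eval_doubleCover_fin {m : ℕ} (X : SimpleGraph (Fin m)) {R : Type*} [CommSemiring R]
    (p : MvPolynomial (Fin (2 * m) × Fin (2 * m)) R)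
    (hp : ∀ σ τ : Perm (Fin (2 * m)), rename (fun q : Fin (2 * m) × Fin (2 * m) => (σ q.1, τ q.2)) p = p) :
    eval (Set.indicator {ij : Fin (2 * m) × Fin (2 * m) |
        ((SimpleGraph.fromRel fun a b : Fin 2 × Fin m => a.1 = b.1 ∧ X.Adj a.2 b.2).comap
          (finProdFinEquiv.symm : Fin (2 * m) → Fin 2 × Fin m)).Adj ij.1 ij.2} 1) p =
      eval (Set.indicator {ij : Fin (2 * m) × Fin (2 * m) |
        ((SimpleGraph.fromRel fun a b : Fin 2 × Fin m => a.1 ≠ b.1 ∧ X.Adj a.2 b.2).comap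
          (finProdFinEquiv.symm : Fin (2 * m) → Fin 2 × Fin m)).Adj ij.1 ij.2} 1) p := by
  obtain ⟨σ, τ, h⟩ := doubleCover_aligned_fin X
  exact (eval_indicator_eq_of_adj_iff p hp _ _ σ τ h).symm

/-- Family form in the route's vocabulary: for a matrix-symmetric family `f` (`IsMatrixSymmetric`), `f (2m)` takes the same value on
the doubling and on the bipartite double cover of every `m`-vertex graph — such pairs can never witness the separation clause of
the kill instruments. [folklore] -/
theorem eval_twoCopies_eq_eval_doubleCover_family (f : (n : ℕ) → MvPolynomial (Fin n × Fin n) ℂ)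
    (hf : IsMatrixSymmetric f) {m : ℕ} (X : SimpleGraph (Fin m)) :
    eval (Set.indicator {ij : Fin (2 * m) × Fin (2 * m) |
        ((SimpleGraph.fromRel fun a b : Fin 2 × Fin m => a.1 = b.1 ∧ X.Adj a.2 b.2).comap
          (finProdFinEquiv.symm : Fin (2 * m) → Fin 2 × Fin m)).Adj ij.1 ij.2} 1) (f (2 * m)) =
      eval (Set.indicator {ij : Fin (2 * m) × Fin (2 * m) |
        ((SimpleGraph.fromRel fun a b : Fin 2 × Fin m => a.1 ≠ b.1 ∧ X.Adj a.2 b.2).comap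
          (finProdFinEquiv.symm : Fin (2 * m) → Fin 2 × Fin m)).Adj ij.1 ij.2} 1) (f (2 * m)) :=
  eval_twoCopies_eq_eval_doubleCover_fin X (f (2 * m)) (hf (2 * m))

end Summit.ValiantsHypothesis.ValiantsHypothesis.Theorems.OrbitRestorationQPDepthThreeRung.BipartiteSplitting

end
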